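import Literature.NumberTheory.GaloisRepresentations.LocalFieldDyadicCharacterKernel
import HarnessLib

/-!
# Dyadic local field with `q = 2`, `e = 1`: the roots of unity are `±1`, every unit is an `m`-th power for `m` odd, and an
# element `c·π^m` (`c` a unit, `m` odd) is the `m`-th power of a UNIFORMISER

Serre, *A Course in Arithmetic* (1973), Ch. II §3.2–3.3 (`ℤ₂^× = {±1} × (1 + 4ℤ₂)`, `1 + 4ℤ₂ ≅ ℤ₂` torsion-free, so the roots of
unity of `ℚ₂` are `±1`; `ℤ₂^×` is a pro-`2` group, hence uniquely `m`-divisible for `m` odd); Neukirch, *Algebraic Number Theory* (1999),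
Ch. II §4 Lemma (4.6) (Hensel), §5 Prop. (5.7).  De Shalit, *Iwasawa theory of elliptic curves with complex multiplication* (1987),
II.1.10 (p. 39): the completed ray class tower `K(𝔤𝔭^∞)_𝔭` is the compositum of an unramified extension with the Lubin–Tate tower of a
uniformiser `π` of `K_𝔭` EXACTLY WHEN the generator `α ≡ 1 mod 𝔤` of `𝔭^f` is the `f`-th power of a uniformiser (`⟨α⟩ = ⟨π^f⟩` as norm
groups) — the binder `hαπ : α = π^f` of the (c)-capstone tower of the `PrintCf2RubinValueTwo` files.  THIS file (sequel of
`LocalFieldDyadicPrincipalUnits` / `LocalFieldDyadicCharacterKernel`; everything PROVED, 0 sorry, no definitions, no named facts)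
supplies the local half of the discharge of that binder:

* ★ `eq_one_of_pi_sq_dvd_of_pow_eq_one` — a torsion element of `U_2` is `1` (`y` of exact level `n ≥ 2` has `y^{2^a(2i+1)}` of exact
  level `n + a`, never `1`);
* ★★ **`eq_one_or_eq_neg_one_of_pow_eq_one`** / `coe_eq_one_or_eq_neg_one_of_pow_eq_one` — **the roots of unity of `F` are `±1`**
  (`𝒪_F^× = ±U_2`);
* ★ `exists_isUnit_pow_eq_of_odd` — **every unit is an `m`-th power for `m` odd** (Hensel for `X^m − c` at `1`: `c ≡ 1 mod π` because
  `𝓀_F = 𝔽₂`, and the derivative `m` is odd, a unit);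
* ★★ **`exists_isUniformizer_pow_eq_of_odd`** — for a unit `c` and `m` odd, `c·π^m = ϖ^m` for a UNIFORMISER `ϖ` (`ϖ = wπ`, `w^m = c`);
  `isUniformizer_units_mul`, `isUniformizer_neg` (`wπ`, `−π` are uniformisers).

Cell `bsd-print-cf2`, width seat `bsd-line-cf2c-w7` g19 (brick (c) at `p = 2`: the `hαπ` binder for class number ODD, see
`Literature/NumberTheory/NumberFields/RayClassFieldTwoVariableFrameGenerator`).

## References
* J.-P. Serre, *A Course in Arithmetic* (1973), Ch. II §3.2 Thm. 3, §3.3. [Serre1973CourseArithmetic]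
* J. Neukirch, *Algebraic Number Theory* (1999), Ch. II §4 Lemma (4.6), §5 Prop. (5.7). [NeukirchANT1999]
* E. de Shalit, *Iwasawa theory of elliptic curves with complex multiplication* (1987), Ch. I §1.1–1.3, Ch. II §1.10 (p. 39). [deShalit1987]
-/

noncomputable section

namespace Literature.NumberTheory.GaloisRepresentations

section DyadicRootsOfUnity

open GaloisRepresentations.IsNonarchimedeanLocalField LubinTate ValuativeRel

variable {F : Type} [Field F] [ValuativeRel F] [TopologicalSpace F] [IsNonarchimedeanLocalField F]

attribute [local instance] ltNormUniformSpace ltNormIsUniformAddGroup rk1 nF nE fintypeResidueField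

variable {π : 𝒪[F]} (hπ : (valuation F).IsUniformizer (π : F)) (hq : residueFieldCard F = 2)
variable {t : 𝒪[F]ˣ} (ht : (2 : 𝒪[F]) = π * t)

/-! ### §1. The roots of unity of `F` are `±1` -/

include hπ ht in
/-- ★ **A torsion element of `U_2` is trivial**: `π² ∣ y − 1`, `y^N = 1`, `N ≠ 0 ⟹ y = 1`.  If `y ≠ 1` it has an exact level `n ≥ 2`;
write `N = 2^a(2i+1)`: odd powers keep the level and each squaring raises it by exactly one (`e = 1`), so `y^N` has exact level `n + a`
and is not `1`. [cite: Serre1973CourseArithmetic, Ch. II §3.3] -/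
theorem eq_one_of_pi_sq_dvd_of_pow_eq_one {y : 𝒪[F]} (hy : π ^ 2 ∣ y - 1) {N : ℕ} (hN : N ≠ 0) (hyN : y ^ N = 1) : y = 1 := by
  by_contra hy1
  have hnot : ¬ ∀ M : ℕ, π ^ M ∣ y - 1 := fun h => hy1 (eq_one_of_forall_pi_pow_dvd hπ h)
  push Not at hnot
  obtain ⟨b, hb⟩ := hnot
  obtain ⟨n, h2n, -, hn, hn'⟩ := exists_pi_pow_dvd_not_dvd_succ hy hb
  obtain ⟨a, m, hm, hNam⟩ := Nat.exists_eq_two_pow_mul_odd hN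
  obtain ⟨i, rfl⟩ := hm
  have h := (pi_pow_dvd_pow_sub_one_and_not hπ ht h2n hn hn' a i).2
  rw [← hNam, hyN, sub_self] at h
  exact h (dvd_zero _)

include hπ hq ht in
/-- ★★ **The roots of unity of `𝒪_F` are `±1`** (`q = 2`, `e = 1`): `x^N = 1`, `N ≠ 0 ⟹ x = 1 ∨ x = −1`.  Every unit is `≡ ±1 mod π²`;
`±x ∈ U_2` is torsion (`(±x)^{2N} = 1`), hence `1`. [cite: Serre1973CourseArithmetic, Ch. II §3.2 Thm. 3, §3.3] -/
theorem eq_one_or_eq_neg_one_of_pow_eq_one {x : 𝒪[F]} {N : ℕ} (hN : N ≠ 0) (hxN : x ^ N = 1) : x = 1 ∨ x = -1 := by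
  have hxu : IsUnit x := IsUnit.of_pow_eq_one hxN hN
  rcases pi_sq_dvd_sub_one_or_add_one hπ hq ht hxu with h | h
  · exact Or.inl (eq_one_of_pi_sq_dvd_of_pow_eq_one hπ ht h hN hxN)
  · right
    have h' : π ^ 2 ∣ (-x) - 1 := by
      rw [show -x - 1 = -(x + 1) by ring, dvd_neg]
      exact h
    have h2N : (-x) ^ (2 * N) = 1 := by
      rw [pow_mul, neg_sq, ← pow_mul, mul_comm, pow_mul, hxN, one_pow]
    have := eq_one_of_pi_sq_dvd_of_pow_eq_one hπ ht h' (by omega) h2N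
    rw [← neg_neg x, this]

include hπ hq ht in
/-- ★★ **The roots of unity of `F` are `±1`**: `x ∈ F`, `x^N = 1`, `N ≠ 0 ⟹ x = 1 ∨ x = −1` (`|x|^N = 1` forces `|x| ≤ 1`, so `x ∈ 𝒪_F`).
[cite: Serre1973CourseArithmetic, Ch. II §3.2 Thm. 3, §3.3] -/
theorem coe_eq_one_or_eq_neg_one_of_pow_eq_one {x : F} {N : ℕ} (hN : N ≠ 0) (hxN : x ^ N = 1) : x = 1 ∨ x = -1 := by
  have h1 : valuation F x ≤ 1 := by
    by_contra h
    push Not at h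
    have hlt := one_lt_pow₀ h hN
    rw [← map_pow, hxN, map_one] at hlt
    exact lt_irrefl _ hlt
  set y : 𝒪[F] := ⟨x, (Valuation.mem_integer_iff _ _).mpr h1⟩ with hy
  have hyN : y ^ N = 1 := Subtype.ext (by rw [hy]; push_cast; exact hxN)
  rcases eq_one_or_eq_neg_one_of_pow_eq_one hπ hq ht hN hyN with h | h
  · left
    have := congrArg Subtype.val h
    simpa [hy] using this
  · right
    have := congrArg Subtype.val h
    simpa [hy] using this

/-! ### §2. Odd roots of units (Hensel) and `m`-th powers of uniformisers -/

include hπ hq ht in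
/-- ★ **Every unit of `𝒪_F` is an `m`-th power for `m` odd**: `c = x^m` with `x` a unit.  Hensel's lemma for `X^m − c` at `X = 1`:
`c ≡ 1 mod π` (`𝓀_F = 𝔽₂`) and the derivative `m·1^{m−1} = m` is odd, i.e. `≡ 1 mod π` — a unit; `𝒪_F` is `𝓂`-adically complete.
[cite: NeukirchANT1999, Ch. II §4 Lemma (4.6)] [cite: Serre1973CourseArithmetic, Ch. II §3.3] -/
theorem exists_isUnit_pow_eq_of_odd {m : ℕ} (hm : Odd m) {c : 𝒪[F]} (hc : IsUnit c) : ∃ x : 𝒪[F], IsUnit x ∧ x ^ m = c := by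
  have hπm : π ∈ 𝓂[F] := (mem_maximalIdeal_iff_valuation_lt_one _).mpr hπ.val_lt_one
  obtain ⟨i, rfl⟩ := hm
  set f : Polynomial 𝒪[F] := Polynomial.X ^ (2 * i + 1) - Polynomial.C c with hf
  have hmonic : f.Monic := by
    rw [hf]
    exact Polynomial.monic_X_pow_sub_C c (Nat.succ_ne_zero _)
  have h0 : f.eval 1 ∈ 𝓂[F] := by
    have h : f.eval 1 = -(c - 1) := by rw [hf]; simp
    rw [h]
    obtain ⟨d, hd⟩ := uniformizer_dvd_sub_one_of_isUnit hπ hq hc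
    rw [hd]
    exact neg_mem (Ideal.mul_mem_right _ _ hπm)
  have h1 : IsUnit (Ideal.Quotient.mk 𝓂[F] (f.derivative.eval 1)) := by
    have h : f.derivative.eval 1 = ((2 * i + 1 : ℕ) : 𝒪[F]) := by rw [hf]; simp
    have e : ((2 * i + 1 : ℕ) : 𝒪[F]) = 1 + π * (t * i) := by
      push_cast
      rw [← mul_assoc, ← ht]; ring
    rw [h, e, map_add, map_one, Ideal.Quotient.eq_zero_iff_mem.mpr (Ideal.mul_mem_right _ _ hπm), add_zero]
    exact isUnit_one
  obtain ⟨x, hx, -⟩ := HenselianRing.is_henselian (I := 𝓂[F]) f hmonic 1 h0 h1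
  have hx' : x ^ (2 * i + 1) = c := by
    have h := hx.eq_zero
    rw [hf, Polynomial.eval_sub, Polynomial.eval_pow, Polynomial.eval_X, Polynomial.eval_C] at h
    exact sub_eq_zero.mp h
  refine ⟨x, ?_, hx'⟩
  have hxc : IsUnit (x * x ^ (2 * i)) := by rw [← pow_succ', hx']; exact hc
  exact isUnit_of_mul_isUnit_left hxc

include hπ in
/-- `wπ` is a uniformiser for a unit `w`. [cite: deShalit1987, Ch. I §1.1] -/
theorem isUniformizer_isUnit_mul {w : 𝒪[F]} (hw : IsUnit w) : (valuation F).IsUniformizer (((w * π : 𝒪[F]) : F)) := by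
  show (valuation F).IsUniformizer (((w : 𝒪[F]) : F) * (π : F))
  have hw1 : valuation F ((w : 𝒪[F]) : F) = 1 := (Valuation.integer.integers (valuation F)).one_of_isUnit hw
  rw [Valuation.IsUniformizer, map_mul, hw1, one_mul]
  exact hπ

include hπ in
/-- `−π` is a uniformiser. [cite: deShalit1987, Ch. I §1.1] -/
theorem isUniformizer_neg : (valuation F).IsUniformizer (((-π : 𝒪[F]) : F)) := by
  have e : (-π : 𝒪[F]) = (-1 : 𝒪[F]) * π := by ring
  rw [e]
  exact isUniformizer_isUnit_mul hπ isUnit_one.neg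

include hπ hq ht in
/-- ★★ **`c·π^m` is the `m`-th power of a uniformiser for a unit `c` and `m` odd**: `c·π^m = ϖ^m` with `ϖ = wπ`, `w^m = c`.  (For `m`
even the class of `c` in `𝒪_F^×/(𝒪_F^×)^{2^{v₂(m)}}` obstructs; cf. `LocalFieldDyadicCharacterKernel.exists_isUnit_pow_two_pow_eq`.)
[cite: NeukirchANT1999, Ch. II §5 Prop. (5.7)] [cite: deShalit1987, Ch. II §1.10 (p. 39)] -/
theorem exists_isUniformizer_pow_eq_of_odd {m : ℕ} (hm : Odd m) {c : 𝒪[F]} (hc : IsUnit c) :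
    ∃ ϖ : 𝒪[F], (valuation F).IsUniformizer (ϖ : F) ∧ ϖ ^ m = c * π ^ m := by
  obtain ⟨w, hw, hwm⟩ := exists_isUnit_pow_eq_of_odd hπ hq ht hm hc
  exact ⟨w * π, isUniformizer_isUnit_mul hπ hw, by rw [mul_pow, hwm]⟩

include hπ hq ht in
/-- The same in `F`: `x ∈ F` with `x = c·π^m` (`c` a unit, `m` odd) is `ϖ^m` for a uniformiser `ϖ`. [cite: deShalit1987, Ch. II §1.10 (p. 39)] -/
theorem exists_isUniformizer_coe_pow_eq_of_odd {m : ℕ} (hm : Odd m) {c : 𝒪[F]} (hc : IsUnit c) {x : F}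
    (hx : x = (c : F) * (π : F) ^ m) : ∃ ϖ : 𝒪[F], (valuation F).IsUniformizer (ϖ : F) ∧ (ϖ : F) ^ m = x := by
  obtain ⟨ϖ, hϖ, hϖm⟩ := exists_isUniformizer_pow_eq_of_odd hπ hq ht hm hc
  refine ⟨ϖ, hϖ, ?_⟩
  have h := congrArg (fun z : 𝒪[F] => (z : F)) hϖm
  push_cast at h
  rw [h, hx]

/-! ### §3. `π ≡ 2 mod π²` and `2 = π·unit` for every uniformiser (`e = 1`) -/

/-- An integer with the valuation of a uniformiser `ϖ` is `ϖ·s` for a unit `s`. [cite: deShalit1987, Ch. I §1.1] -/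
theorem exists_isUnit_eq_mul_of_valuation_eq {ϖ : 𝒪[F]} (hϖ : (valuation F).IsUniformizer (ϖ : F)) {x : 𝒪[F]}
    (hx : valuation F (x : F) = valuation F (ϖ : F)) : ∃ s : 𝒪[F], IsUnit s ∧ x = ϖ * s := by
  have hϖ0 : (ϖ : F) ≠ 0 := hϖ.ne_zero
  have hs1 : valuation F ((x : F) / (ϖ : F)) = 1 := by
    rw [map_div₀, hx, div_self ((Valuation.ne_zero_iff _).mpr hϖ0)]
  set s : 𝒪[F] := ⟨(x : F) / (ϖ : F), hs1.le⟩ with hs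
  have hsu : IsUnit s := (Valuation.Integers.isUnit_iff_valuation_eq_one (Valuation.integer.integers (valuation F))).mpr hs1
  refine ⟨s, hsu, Subtype.ext ?_⟩
  change (x : F) = (ϖ : F) * ((x : F) / (ϖ : F))
  rw [mul_div_cancel₀ _ hϖ0]

include hπ hq ht in
/-- For EVERY uniformiser `ϖ` of `F` (`q = 2`, `e = 1`): `2 = ϖ·s` with `s` a unit, and `ϖ² ∣ ϖ − 2` (`s ≡ 1 mod ϖ`).  These are the
binders `hu` / `hm` (`m₁ = 2`) of the (c)-capstone frame for the uniformiser produced by §2.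
[cite: deShalit1987, Ch. I §1.1, §3.12] [cite: Serre1973CourseArithmetic, Ch. II §3.3] -/
theorem exists_two_eq_mul_isUnit_and_sq_dvd_sub_two {ϖ : 𝒪[F]} (hϖ : (valuation F).IsUniformizer (ϖ : F)) :
    ∃ s : 𝒪[F], IsUnit s ∧ (2 : 𝒪[F]) = ϖ * s ∧ ϖ ^ 2 ∣ ϖ - 2 := by
  have h2 : valuation F ((2 : 𝒪[F]) : F) = valuation F (ϖ : F) := by
    have ht1 : valuation F ((t : 𝒪[F]) : F) = 1 := (Valuation.integer.integers (valuation F)).one_of_isUnit t.isUnit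
    have e : ((2 : 𝒪[F]) : F) = (π : F) * ((t : 𝒪[F]) : F) := by exact_mod_cast ht
    rw [e, map_mul, ht1, mul_one]
    rw [Valuation.IsUniformizer] at hϖ hπ
    rw [hϖ, hπ]
  obtain ⟨s, hsu, hs⟩ := exists_isUnit_eq_mul_of_valuation_eq hϖ h2
  refine ⟨s, hsu, hs, ?_⟩
  obtain ⟨d, hd⟩ := uniformizer_dvd_sub_one_of_isUnit hϖ hq hsu
  refine ⟨-d, ?_⟩
  rw [hs]
  linear_combination (-ϖ) * hd

end DyadicRootsOfUnity

end Literature.NumberTheory.GaloisRepresentations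

end
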